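import Mathlib
import Summits.NavierStokesRegularity.NavierStokesRegularity.Theorems.EulerZoomLiouvillePowerGaugeEulerLiouvilleSelfSimilarVorticalNodeThin
import Summits.NavierStokesRegularity.NavierStokesRegularity.Theorems.EulerZoomLiouvillePowerGaugeEulerLiouvilleSelfSimilarSaddleContinuumPlane
import Summits.NavierStokesRegularity.NavierStokesRegularity.Theorems.EulerZoomLiouvillePowerGaugeEulerLiouvilleSelfSimilarNoDriftBadNode
import Literature.Analysis.FluidPDE.SelfSimilarEulerStagnationStretching
import HarnessLib

/-!
# Rung C1 of the crux `EulerZoomLiouville.PowerGaugeEulerLiouville`: THE BACKWARD BASIN OF THE BAD SET IS NULL, and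
# the classical stratum is EMPTY — a smooth self-similar Euler profile with the far field (3.8), `0 < γ < ½`, is
# trivial (route №10, item stmt-NavierStokesRegularity-19832; `--supports`)

Helper file (theorems only). Seat ns-typeII-p3 (cell ns-regularity-ideate §B, D-0081).  Assembly of
`…SelfSimilarNonVorticalBadNode` (every non-vortical BAD node is thin), `…SelfSimilarVorticalNodeThin` (every
VORTICAL stagnation point is thin) and typeII-p2's `…SelfSimilarNoDriftBadNode` (every vortical backward trajectory
converges to one bad node):

* `exists_trappedSet_null_of_bad` — at every bad stagnation point (`1 ≤ ⟪DV(z)w, w⟫` for a unit `w`) of a classical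
  profile with `0 < γ < ½`, a null `Φ_T`-trapped set — NO linearisation hypothesis;
* **`volume_setOf_tendsto_flow_atBot_mem_badSet_eq_zero`** — `0 < γ < ½`, `V` smooth, (3.8): the set of points whose
  backward similarity trajectory converges to SOME bad stagnation point is Lebesgue-null (cover argument over the
  compact bad set);
* **`eq_zero_of_smooth_of_farField`** — THE CLASSICAL STRATUM OF RUNG C1, UNCONDITIONAL: `0 < γ < ½`, `V` smooth,
  `IsSelfSimilarEulerProfile γ 0 V P`, far-field bounds (3.8) ⇒ `V ≡ 0`.  Composition with typeII-p2's no-drift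
  theorem `NoDrift.tendsto_flow_atBot_of_curl_ne_zero` (every vortical backward trajectory converges to one BAD
  node, built on typeII-p1's limit-set kill `NodalContinuum.exists_badNode_mapClusterPt_of_curl_ne_zero`):
  `{curl V ≠ 0}` ⊆ backward basin of the bad set = null, open ⇒ empty ⇒ `curl V ≡ 0` ⇒ `V ≡ 0`;
* `selfSimilar_ae_eq_zero_of_smooth_of_farField` — member level, `γ = 1/(2+ρ)`, any `ρ > 0`: an exactly
  self-similar field with such a profile vanishes a.e. on `(−∞,0) × ℝ³` (the classical-(3.8) stratum of the
  registered residue `stub_selfSimilarExtremalRest` of crux E).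

The three lineages' hypotheses of yesterday — finite / countable stagnation set (p2), nondegenerate bad nodes (p1),
drift coordinate + block data (p3) — are all gone: no hypothesis on `𝒩_W`, none on the linearisations.

WHAT THIS IS NOT: not NS, not E, not rung C1 — the CLASSICAL stratum (smooth profile with CIV's far field (3.8));
the weak (`H¹_loc`) profiles and classical profiles violating (3.8) are untouched.
[folklore assembly; cf. ConstantinIgnatovaVicol2026Putative §3.5 Thm 3.10; Robinson1999 Ch. V §5.10.1]
-/

noncomputable section

-- flat `Theorems/<Route><Decl>…` files of one crux share the namespace of the crux (tree convention)
set_option linter.dupNamespace false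

open MeasureTheory Set Filter Topology Metric Function InnerProductSpace
open scoped RealInnerProductSpace NNReal ContDiff

namespace Summit.NavierStokesRegularity.NavierStokesRegularity.Theorems.PowerGaugeEulerLiouville.Kelvin

open Literature.Analysis Literature.Analysis.FluidPDE Literature.Dynamics.FixedPoints

variable {γ : ℝ} {V : EuclideanSpace ℝ (Fin 3) → EuclideanSpace ℝ (Fin 3)} {P : EuclideanSpace ℝ (Fin 3) → ℝ}

/-- **Every bad stagnation point is thin.**  `(V, P)` classical, `V` smooth, `‖DV‖ ≤ K`, `0 < γ < ½`, `z ∈ 𝒩_W` with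
`1 ≤ ⟪DV(z)w, w⟫` for a unit `w` ⇒ a null `Φ_T`-trapped set near `z` (non-vortical: symmetric thin block form,
`exists_thinBlock_of_curl_eq_zero_of_bad`; vortical: `exists_trappedSet_null_of_curl_ne_zero`).
[cite: Robinson1999, Ch. V §5.10.1 (cone estimate, dominated form; proved in the tree)] -/
theorem exists_trappedSet_null_of_bad (hV : ContDiff ℝ ∞ V) {K : ℝ} (hK : ∀ y, ‖fderiv ℝ V y‖ ≤ K)
    (hprof : IsSelfSimilarEulerProfile γ 0 V P) (hγ : 0 < γ) (hγ2 : γ < 1 / 2)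
    {z : EuclideanSpace ℝ (Fin 3)} (hz : z ∈ selfSimilarNodalSet γ 0 V)
    (hbad : ∃ w : EuclideanSpace ℝ (Fin 3), ‖w‖ = 1 ∧ 1 ≤ ⟪fderiv ℝ V z w, w⟫) :
    ∃ T : ℝ, 0 < T ∧ ∃ r : ℝ, 0 < r ∧ volume {q : EuclideanSpace ℝ (Fin 3) | ∃ qs : ℕ → EuclideanSpace ℝ (Fin 3),
      qs 0 = q ∧ (∀ k, ODE.evolutionMap (fun _ : ℝ => selfSimilarTransport γ 0 V) 0 T (qs (k + 1)) = qs k) ∧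
        ∀ k, qs k ∈ ball z r} = 0 := by
  by_cases hcurl : curl V z = 0
  · obtain ⟨b, lam, β, hA0, hA1, hA2, hshape⟩ :=
      exists_thinBlock_of_curl_eq_zero_of_bad (hV.differentiable (by simp)) hprof.divFree hγ2 hcurl hbad
    rcases hshape with ⟨h2, h20, h21⟩ | ⟨h0, h1, h02, h12⟩
    · exact exists_trappedSet_null_of_dominatedBlock hV hK hz b lam β hA0 hA1 hA2 h2 h20 h21
    · exact exists_trappedSet_null_of_contractingPlane hV hK hz b lam β hA0 hA1 hA2 h0 h1 h02 h12
  · exact exists_trappedSet_null_of_curl_ne_zero hV hK hprof (by linarith) hγ2 hz hcurl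

/-- **THE BACKWARD BASIN OF THE BAD SET IS NULL.**  `(V, P)` classical, `V` smooth, `0 < γ < ½`, far-field bounds
(3.8).  The set of points whose backward similarity trajectory converges to some BAD stagnation point
(`1 ≤ ⟪DV(z)w, w⟫` for a unit `w`) is Lebesgue-null — no hypothesis on the stagnation set or on the linearisations
(compact bad set `isCompact_badNodalSet` + `exists_trappedSet_null_of_bad` + the cover argument).
[cite: Robinson1999, Ch. V §5.10.1 (cone estimate, dominated form; proved in the tree)] -/
theorem volume_setOf_tendsto_flow_atBot_mem_badSet_eq_zero (hV : ContDiff ℝ ∞ V)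
    (hprof : IsSelfSimilarEulerProfile γ 0 V P) (hγ : 0 < γ) (hγ2 : γ < 1 / 2)
    {C₀ : ℝ} (hfar : HasSelfSimilarFarFieldWith γ 0 C₀ V) :
    volume {x : EuclideanSpace ℝ (Fin 3) | ∃ z ∈ {z | z ∈ selfSimilarNodalSet γ 0 V ∧
        ∃ w : EuclideanSpace ℝ (Fin 3), ‖w‖ = 1 ∧ 1 ≤ ⟪fderiv ℝ V z w, w⟫},
      Tendsto (fun s => ODE.evolutionMap (fun _ : ℝ => selfSimilarTransport γ 0 V) 0 s x) atBot (𝓝 z)} = 0 := by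
  have hK : ∀ y, ‖fderiv ℝ V y‖ ≤ C₀ := norm_fderiv_le_const_of_farField hγ hfar
  exact volume_setOf_tendsto_flow_atBot_mem_eq_zero_of_trappedSets hV hK (isCompact_badNodalSet hV hγ hfar)
    fun z hz => exists_trappedSet_null_of_bad hV hK hprof hγ hγ2 hz.1 hz.2

/-- **RUNG C1, CLASSICAL STRATUM WITH THE FAR FIELD (3.8) — UNCONDITIONAL.**  Let `(V, P)` be a classical
self-similar Euler profile (CIV (3.3)) with `V` smooth, exponent `0 < γ < ½`, and the far-field bounds (3.8).  Then
`V ≡ 0`.  Proof: the backward similarity trajectory of every VORTICAL point converges to one BAD stagnation point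
(typeII-p2's no-drift theorem `NoDrift.tendsto_flow_atBot_of_curl_ne_zero`, on typeII-p1's limit-set kill); the
backward basin of the bad set is null (`volume_setOf_tendsto_flow_atBot_mem_badSet_eq_zero`: every bad node is
thin); so `{curl V ≠ 0}` is an open null set, `curl V ≡ 0`, and a div-free curl-free field with `DV → 0` and
`V(0) = 0` vanishes.  NO hypothesis on the stagnation set `𝒩_W` (finite, countable or continua) and NONE on the
linearisations (hyperbolic, degenerate or defective).
[cite: ConstantinIgnatovaVicol2026Putative, §3.5 Thm 3.10 (there: finite 𝒩, outgoing condition, analyticity — all three hypotheses removed here); Robinson1999, Ch. V §5.10.1] -/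
theorem eq_zero_of_smooth_of_farField (hV : ContDiff ℝ ∞ V)
    (hprof : IsSelfSimilarEulerProfile γ 0 V P) (hγ : 0 < γ) (hγ2 : γ < 1 / 2)
    {C₀ : ℝ} (hfar : HasSelfSimilarFarFieldWith γ 0 C₀ V) :
    V = 0 := by
  set B : Set (EuclideanSpace ℝ (Fin 3)) := {z | z ∈ selfSimilarNodalSet γ 0 V ∧
    ∃ w : EuclideanSpace ℝ (Fin 3), ‖w‖ = 1 ∧ 1 ≤ ⟪fderiv ℝ V z w, w⟫} with hB
  have hnull := volume_setOf_tendsto_flow_atBot_mem_badSet_eq_zero hV hprof hγ hγ2 hfar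
  have hsub : {x : EuclideanSpace ℝ (Fin 3) | curl V x ≠ 0} ⊆ {x : EuclideanSpace ℝ (Fin 3) | ∃ z ∈ B,
      Tendsto (fun s => ODE.evolutionMap (fun _ : ℝ => selfSimilarTransport γ 0 V) 0 s x) atBot (𝓝 z)} := by
    intro x hx
    obtain ⟨z, hzN, hbad, hz⟩ := NoDrift.tendsto_flow_atBot_of_curl_ne_zero hV hprof hγ hγ2 hfar hx
    exact ⟨z, ⟨hzN, hbad⟩, hz⟩
  have hopen : IsOpen {x : EuclideanSpace ℝ (Fin 3) | curl V x ≠ 0} := by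
    have hV2 : ContDiff ℝ 2 V := hV.of_le (by norm_cast)
    exact isOpen_ne_fun (differentiable_curl_of_contDiff hV2).continuous continuous_const
  have hzero : volume {x : EuclideanSpace ℝ (Fin 3) | curl V x ≠ 0} = 0 := measure_mono_null hsub hnull
  have hempty : {x : EuclideanSpace ℝ (Fin 3) | curl V x ≠ 0} = ∅ := (hopen.measure_eq_zero_iff volume).1 hzero
  have hcurl : ∀ x, curl V x = 0 := by
    intro x
    by_contra hx
    have : x ∈ ({x : EuclideanSpace ℝ (Fin 3) | curl V x ≠ 0} : Set _) := hx
    rw [hempty] at this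
    exact this
  funext y
  rw [eq_of_curl_eq_zero_of_isDivFree_of_fderiv_tendsto_zero (hV.of_le (by norm_cast)) hcurl hprof.divFree
    (hfar.tendsto_norm_fderiv hγ) y 0, hfar.apply_center]
  rfl

/-- **MEMBER LEVEL (the classical-(3.8) stratum of `stub_selfSimilarExtremalRest`, any `ρ > 0`).**  An exactly
self-similar field `u(τ) = selfSimilarCollapse (1/(2+ρ)) 0 V τ` (`τ < 0`) whose profile is classical — `V` smooth,
`IsSelfSimilarEulerProfile (1/(2+ρ)) 0 V P` — and satisfies the far-field bounds (3.8) vanishes a.e. on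
`(−∞, 0) × ℝ³`.  Unconditional: no named fact, no hypothesis on the stagnation set or the linearisations.
[cite: ConstantinIgnatovaVicol2026Putative, §3.5 Thm 3.10 (strengthened)] -/
theorem selfSimilar_ae_eq_zero_of_smooth_of_farField {ρ : ℝ} (hρ : 0 < ρ)
    (u : ℝ → EuclideanSpace ℝ (Fin 3) → EuclideanSpace ℝ (Fin 3))
    (hu : ∀ τ : ℝ, τ < 0 → u τ = selfSimilarCollapse (1 / (2 + ρ)) 0 V τ)
    (hV : ContDiff ℝ ∞ V) (hprof : IsSelfSimilarEulerProfile (1 / (2 + ρ)) 0 V P)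
    (hfar : HasSelfSimilarFarField (1 / (2 + ρ)) 0 V) :
    uncurry u =ᵐ[volume.restrict (Iio (0 : ℝ) ×ˢ (univ : Set (EuclideanSpace ℝ (Fin 3))))] 0 := by
  have h2ρ : (0 : ℝ) < 2 + ρ := by linarith
  have hγ : (0 : ℝ) < 1 / (2 + ρ) := one_div_pos.2 h2ρ
  have hγ2 : 1 / (2 + ρ) < 1 / 2 := one_div_lt_one_div_of_lt two_pos (by linarith)
  obtain ⟨C, hC⟩ := hfar
  exact selfSimilar_ae_eq_zero_of_profile_eq_zero u hu (eq_zero_of_smooth_of_farField hV hprof hγ hγ2 hC)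

end Summit.NavierStokesRegularity.NavierStokesRegularity.Theorems.PowerGaugeEulerLiouville.Kelvin

end
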